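import Mathlib
import HarnessLib
import Summits.HubbardSuperconductivity.HubbardSuperconductivity.Theorems.KLProgrammeKLRegimeTwoVolumeTowerTruncDefs
import Summits.HubbardSuperconductivity.HubbardSuperconductivity.Theorems.KLProgrammeKLRegimeTwoVolumeDataKitWt
import Summits.HubbardSuperconductivity.HubbardSuperconductivity.Theorems.KLProgrammeKLRegimeVolumeLimitV9GluedSrcPairDoorAt

/-!
# Route `KLProgramme` — crux K3, VL child `KLRegimeVolumeLimitV17F2` (stmt-HubbardSuperconductivity-20440), blueprint v5 M5-T: THE PROFILE FIELD OF THE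
# SOURCE-TRUNCATED BUNDLE FROM THE PRODUCERS' CURRENCY (located «(VL)-SRC-HIGH»; seat hubbard-kl-k3c4-p1 g14; `--supports` 20440)

`…TowerTruncDefs.TowerVolumeDataT.profile` asks, at step `j`, for `WtProfileEven (srcTrunc 3 (klTowerD V M β U μ K j)) (Λ j) (ε·NV j)`: the
`(1 + labelDiam(Λ_j·tnorm))`-weighted pinned profile, in even degrees, of the SOURCE-TRUNCATED doubled read-out `klTowerD … j = map (ε•klSrcAnalysisAt … j) 𝒱_{j+1}`.
The producers speak token #24's currency `klSrcPinnedSumAt V M β U μ K J r n s m q w` (`…TwoVolumeSourceProfileDefs`): the `klScaleWt r`-weighted pinned sum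
of the strings of `klSrcActionAt … J n` with EXACTLY `s` source legs — E1's alive read-out is `s = 0` (all-copy-`0` strings; `kernel_klSrcActionAt_alive` reads
the `F_J`-sectorised kernels of `𝒱_n`), token #24 (`SourceProfilesAtLev`) is `s ∈ {1, 2}`.  This file is the dictionary:

* `norm_kernel_klTowerD_eq` — `‖kernel (klTowerD … j) m X‖ = ε^m · ‖kernel (klSrcActionAt … j (j+1)) m X‖` (`kernel_map_smul_klSrcAnalysisAt`);
* `sum_srcCount_filter_eq_eps_mul_klSrcPinnedSumAt` — the `klScaleWt r`-weighted pinned sum of `klTowerD … j` over the strings with `srcCount = s`, degree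
  `2m′ ≥ 2`, IS `ε · klSrcPinnedSumAt … j r (j+1) s (2m′) q w`;
* **`wtProfileEven_srcTrunc_klTowerD_of_srcPinnedSumAt`** — if `klSrcPinnedSumAt … j r (j+1) s m q w ≤ S s m` for `s ≤ 2` and all `m q w`, and
  `Λ ≤ Λ_r`, then `WtProfileEven (srcTrunc 3 (klTowerD … j)) Λ (fun m => ε · (S 0 (2m) + S 1 (2m) + S 2 (2m)))` — the field `TowerVolumeDataT.profile` at
  step `j` with the volume-free budget `NV j m := S 0 (2m) + S 1 (2m) + S 2 (2m)`.

So E1's (R75f)(a) read-out at `(J, n) = (j, j+1)` ⊕ `SourceProfilesAtLev S … j r (j+1)` discharge the profile field, scale by scale, with no other input.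
Proofs only; no definition. [cite: BenfattoGiulianiMastropietro2006, §2.7 (2.70)–(2.71), §2.9 (4.3)–(4.6)]
-/

noncomputable section

namespace Summit.HubbardSuperconductivity.HubbardSuperconductivity.Theorems.TwoVolumeSource

set_option linter.dupNamespace false -- summit = problem name (single-conjunct summit), D-0017

open Finset Filter Topology Literature.MathematicalPhysics.QuantumLattice GrassmannAlgebra Literature.Probability.LatticeModels
  Literature.Probability.LatticeModels.BattleFederbush
open Summit.HubbardSuperconductivity.HubbardSuperconductivity.Theorems.TwoPointAssembly
open Summit.HubbardSuperconductivity.HubbardSuperconductivity.Theorems.KLRegimeSplit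
open Summit.HubbardSuperconductivity.HubbardSuperconductivity.Theorems.KLProgrammeLegKernels
open Summit.HubbardSuperconductivity.HubbardSuperconductivity.Theorems.EngineV8
open Summit.HubbardSuperconductivity.HubbardSuperconductivity.Theorems.TwoVolumeDefect

variable {V M : ℕ} [NeZero V] [NeZero M]

omit [NeZero M] in
/-- **The kernels of the doubled read-out carry `ε^m`**: `‖kernel (klTowerD … j) m X‖ = ε^m · ‖kernel (klSrcActionAt … j (j+1)) m X‖` (`0 ≤ β`). [folklore] -/
theorem norm_kernel_klTowerD_eq {β : ℝ} (hβ : 0 ≤ β) (U μ : ℝ) (K : TrigPolyC4v) (j m : ℕ) (X : Fin m → SrcLabel V M j) :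
    ‖kernel ℂ (klTowerD V M β U μ K j) m X‖ = imagTimeWeight β M ^ m * ‖kernel ℂ (klSrcActionAt V M β U μ K j (j + 1)) m X‖ := by
  have hε : 0 ≤ imagTimeWeight β M := by unfold imagTimeWeight; positivity
  rw [klTowerD, kernel_map_smul_klSrcAnalysisAt, norm_mul, norm_pow, Complex.norm_real, Real.norm_of_nonneg hε]

omit [NeZero M] in
/-- **The `srcCount = s` part of the weighted pinned sum of `klTowerD … j` in degree `m ≥ 1` is `ε · klSrcPinnedSumAt … s m`** (`0 ≤ β`). [folklore] -/
theorem sum_srcCount_filter_eq_eps_mul_klSrcPinnedSumAt {β : ℝ} (hβ : 0 ≤ β) (U μ : ℝ) (K : TrigPolyC4v) (j r s m : ℕ) (hm : 1 ≤ m) (q : Fin m)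
    (w : SrcLabel V M j) :
    ∑ Y ∈ univ.filter (fun Y : Fin m → SrcLabel V M j => Y q = w ∧ srcCount (fun q : SrcLabel V M j => q.2 = 1) Y = s),
        klScaleWt V M β r ((univ.image Y).image (srcLegPos V M (2 * (2 * M)))) * ‖kernel ℂ (klTowerD V M β U μ K j) m Y‖ =
      imagTimeWeight β M * klSrcPinnedSumAt V M β U μ K j r (j + 1) s m q w := by
  rw [klSrcPinnedSumAt_def, mul_sum, mul_sum]
  refine sum_congr rfl fun Y _ => ?_
  have hpow : imagTimeWeight β M ^ m = imagTimeWeight β M * imagTimeWeight β M ^ (m - 1) := by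
    rw [← pow_succ', Nat.sub_add_cancel hm]
  rw [norm_kernel_klTowerD_eq hβ, hpow]
  ring

/-- **`TowerVolumeDataT.profile` FROM THE PRODUCERS' CURRENCY** (see the module docstring): bounds `S s m` on `klSrcPinnedSumAt … j r (j+1) s m q w` for
`s ≤ 2` give the weighted even profile of `srcTrunc 3 (klTowerD … j)` at any rate `Λ ≤ Λ_r` with budget `ε · (S 0 (2m) + S 1 (2m) + S 2 (2m))`.
[cite: BenfattoGiulianiMastropietro2006, §2.9 (4.3)-(4.6)] -/
theorem wtProfileEven_srcTrunc_klTowerD_of_srcPinnedSumAt {β : ℝ} (hβ : 0 < β) (U μ : ℝ) (K : TrigPolyC4v) (j r : ℕ) {Λ : ℝ}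
    (hΛr : Λ ≤ klScale klE0 r) (S : ℕ → ℕ → ℝ) (hS0 : ∀ s m, 0 ≤ S s m)
    (h : ∀ s, s ≤ 2 → ∀ (m : ℕ) (q : Fin m) (w : SrcLabel V M j), klSrcPinnedSumAt V M β U μ K j r (j + 1) s m q w ≤ S s m) :
    WtProfileEven (srcTrunc ℂ (fun q : SrcLabel V M j => q.2 = 1) 3 (klTowerD V M β U μ K j)) Λ
      (fun m => imagTimeWeight β M * (S 0 (2 * m) + S 1 (2 * m) + S 2 (2 * m))) := by
  classical
  have hε : 0 < imagTimeWeight β M := by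
    have hM : (0 : ℝ) < M := Nat.cast_pos.2 (Nat.pos_of_ne_zero (NeZero.ne M))
    unfold imagTimeWeight; positivity
  refine ⟨fun m => mul_nonneg hε.le (add_nonneg (add_nonneg (hS0 0 _) (hS0 1 _)) (hS0 2 _)), fun m' jx x => ?_⟩
  -- degree `0` has no pin
  rcases m' with _ | m₁
  · exact jx.elim0
  -- abbreviations
  set P : SrcLabel V M j → Prop := fun q => q.2 = 1 with hP
  set D := klTowerD V M β U μ K j with hD
  set wt : (Fin (2 * (m₁ + 1)) → SrcLabel V M j) → ℝ := fun Y =>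
    1 + labelDiam (fun Y₁ Y₂ : SrcLabel V M j => Λ * (Torus.tnorm (Y₁.1.1.2 - Y₂.1.1.2) : ℝ)) (univ.image Y) with hwt
  set g : ℕ → (Fin (2 * (m₁ + 1)) → SrcLabel V M j) → ℝ := fun s Y =>
    if srcCount P Y = s then klScaleWt V M β r ((univ.image Y).image (srcLegPos V M (2 * (2 * M)))) * ‖kernel ℂ D (2 * (m₁ + 1)) Y‖ else 0 with hg
  have hwt0 : ∀ Y, 0 ≤ wt Y := fun Y => add_nonneg zero_le_one (labelDiam_nonneg _ _)
  have hwtle : ∀ Y, wt Y ≤ klScaleWt V M β r ((univ.image Y).image (srcLegPos V M (2 * (2 * M)))) :=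
    fun Y => one_add_labelDiam_mul_tnorm_le_klScaleWt_src hβ.le hΛr Y
  have hg0 : ∀ s Y, 0 ≤ g s Y := fun s Y => by
    simp only [hg]; split_ifs
    · exact mul_nonneg (zero_le_one.trans (one_le_klScaleWt _ _ _ _ _)) (norm_nonneg _)
    · exact le_rfl
  -- termwise: the truncated term is below `g 0 + g 1 + g 2`
  have hterm : ∀ Y : Fin (2 * (m₁ + 1)) → SrcLabel V M j,
      ‖kernel ℂ (srcTrunc ℂ P 3 D) (2 * (m₁ + 1)) Y‖ * wt Y ≤ g 0 Y + g 1 Y + g 2 Y := by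
    intro Y
    rw [kernel_srcTrunc]
    by_cases hlt : srcCount P Y < 3
    · rw [if_pos hlt]
      have hb : ‖kernel ℂ D (2 * (m₁ + 1)) Y‖ * wt Y ≤ klScaleWt V M β r ((univ.image Y).image (srcLegPos V M (2 * (2 * M)))) * ‖kernel ℂ D (2 * (m₁ + 1)) Y‖ := by
        rw [mul_comm]; exact mul_le_mul_of_nonneg_right (hwtle Y) (norm_nonneg _)
      have h0 := hg0 0 Y; have h1 := hg0 1 Y; have h2 := hg0 2 Y
      interval_cases hs : srcCount P Y
      · have : g 0 Y = klScaleWt V M β r ((univ.image Y).image (srcLegPos V M (2 * (2 * M)))) * ‖kernel ℂ D (2 * (m₁ + 1)) Y‖ := by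
          simp only [hg, hs, if_true]
        linarith
      · have : g 1 Y = klScaleWt V M β r ((univ.image Y).image (srcLegPos V M (2 * (2 * M)))) * ‖kernel ℂ D (2 * (m₁ + 1)) Y‖ := by
          simp only [hg, hs, if_true]
        linarith
      · have : g 2 Y = klScaleWt V M β r ((univ.image Y).image (srcLegPos V M (2 * (2 * M)))) * ‖kernel ℂ D (2 * (m₁ + 1)) Y‖ := by
          simp only [hg, hs, if_true]
        linarith
    · rw [if_neg hlt, norm_zero, zero_mul]
      exact add_nonneg (add_nonneg (hg0 0 Y) (hg0 1 Y)) (hg0 2 Y)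
  -- the `g s` sums are `ε · klSrcPinnedSumAt … s`
  have hsum : ∀ s, ∑ Y ∈ univ.filter (fun Y : Fin (2 * (m₁ + 1)) → SrcLabel V M j => Y jx = x), g s Y =
      imagTimeWeight β M * klSrcPinnedSumAt V M β U μ K j r (j + 1) s (2 * (m₁ + 1)) jx x := by
    intro s
    simp only [hg]
    rw [← sum_filter, filter_filter]
    exact sum_srcCount_filter_eq_eps_mul_klSrcPinnedSumAt hβ.le U μ K j r s (2 * (m₁ + 1)) (by omega) jx x
  -- assemble
  calc ∑ Y ∈ univ.filter (fun Y : Fin (2 * (m₁ + 1)) → SrcLabel V M j => Y jx = x), ‖kernel ℂ (srcTrunc ℂ P 3 D) (2 * (m₁ + 1)) Y‖ * wt Y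
      ≤ ∑ Y ∈ univ.filter (fun Y : Fin (2 * (m₁ + 1)) → SrcLabel V M j => Y jx = x), (g 0 Y + g 1 Y + g 2 Y) := sum_le_sum fun Y _ => hterm Y
    _ = imagTimeWeight β M * (klSrcPinnedSumAt V M β U μ K j r (j + 1) 0 (2 * (m₁ + 1)) jx x +
          klSrcPinnedSumAt V M β U μ K j r (j + 1) 1 (2 * (m₁ + 1)) jx x + klSrcPinnedSumAt V M β U μ K j r (j + 1) 2 (2 * (m₁ + 1)) jx x) := by
        rw [sum_add_distrib, sum_add_distrib, hsum 0, hsum 1, hsum 2]; ring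
    _ ≤ imagTimeWeight β M * (S 0 (2 * (m₁ + 1)) + S 1 (2 * (m₁ + 1)) + S 2 (2 * (m₁ + 1))) :=
        mul_le_mul_of_nonneg_left (add_le_add (add_le_add (h 0 (by norm_num) _ jx x) (h 1 (by norm_num) _ jx x)) (h 2 le_rfl _ jx x)) hε.le

end Summit.HubbardSuperconductivity.HubbardSuperconductivity.Theorems.TwoVolumeSource

end
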